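import Literature.Topology.FourManifolds.LeeFilteredElim
import Literature.Topology.FourManifolds.LeeRasmussenHtpyProofs
import Literature.Topology.FourManifolds.KhBigonRotate
import Literature.Topology.FourManifolds.KhTriangleIso
import Literature.Topology.FourManifolds.KhOmega3Degenerate
import Literature.Topology.FourManifolds.GaussDiagramParity
import HarnessLib

/-!
# Invariance of Rasmussen's `s` under the Reidemeister moves of Gauss diagrams

Sibling file of `LeeRasmussen.lean`, discharging the named fact
`GaussDiagram.rasmussenInvariant_eq_of_equiv` (`rasmussenInvariant_eq_of_equiv_holds`):
**two realisable Gauss diagrams related by Polyak's Reidemeister moves have the same `s`**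
(Rasmussen (2010), Thm. 1). The proof assembles three developments of this library:

1. *Parity* (`GaussDiagramParity`, Manturov (2010), Thm. 2 with `k = 1`): realisable diagrams
   are all-even (Gauss), and two all-even diagrams which are equivalent through arbitrary Gauss
   diagrams are equivalent through all-even diagrams (`evenEquiv_of_equiv`); along such a chain
   every edge of every cube of resolutions is a merge or a split
   (`isMergeAt_or_isSplitAt_of_overPos_mod_two_ne`), which is what the homological algebra of
   the moves needs (for virtual intermediate diagrams `d² ≠ 0` and `s` does change).
2. *The moves on Lee's complex* (the Khovanov-homology programme `KhCurlHomotopyPos/Neg`,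
   `KhBigonHomotopy`, `KhTriangleIso`, `KhOmega3Degenerate`, over the universal Frobenius system,
   here at `(ℚ, h = 0, t = 1)`): explicit homotopy equivalences for `Ω1`, `Ω2`, `Ω3`, reduced to
   normal position by rotations (`KhCurlRotate`, `KhBigonRotate`).
3. *Filtrations* (`LeeRasmussenHtpyProofs`, `LeeFilteredElim`, Rasmussen (2010), §6): these
   homotopy equivalences are filtered of degree `0` for the quantum filtration — checked here
   move by move (`qFiltered_curlPosF`, …, `isFilt_bigonMHtpy`, `isFilt_loopMHtpy`) — so they
   preserve `s_max` and `s` (`rasmussenInvariant_eq_of_qFiltered`); the bookkeeping move is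
   `rasmussenInvariant_eq_of_isRelabelling` (`LeeRasmussenProofs`).

Main results: `rasmussenInvariant_curl`, `rasmussenInvariant_omega1a/omega1b`,
`rasmussenInvariant_bigon`, `rasmussenInvariant_omega2a`, `rasmussenInvariant_braidMove`,
`rasmussenInvariant_omega3a`, `rasmussenInvariant_eq_of_evenMove`,
`rasmussenInvariant_eq_of_evenEquiv`, `allEven_of_hasGaussDiagram`,
`rasmussenInvariant_eq_of_equiv_holds`.

Everything is proved; no named fact is introduced.

## References

* J. Rasmussen, *Khovanov homology and the slice genus*, Invent. Math. 182 (2010) 419–447,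
  Thm. 1 and §6 (its proof: the Reidemeister maps are filtered of degree `0`). [cite: Rasmussen2010, §6]
* E. S. Lee, *An endomorphism of the Khovanov invariant*, Adv. Math. 197 (2005), §3–4. [cite: Lee2005]
* M. Khovanov, *A categorification of the Jones polynomial*, Duke Math. J. 101 (2000), §5
  (invariance under the Reidemeister moves). [cite: Khovanov2000, §5]
* V. O. Manturov, *Parity in knot theory*, Sb. Math. 201 (2010) 693–733 / *Free knots and
  parity*, §3.2, Thm. 2 (the projection to even diagrams). [cite: Manturov2011, §3.2 Thm. 2]
* M. Goussarov, M. Polyak, O. Viro, *Finite-type invariants of classical and virtual knots*,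
  Topology 39 (2000), Thm. 1.B (context: realisable diagrams related by moves through virtual
  diagrams present isotopic knots). [cite: GoussarovPolyakViro2000, Thm. 1.B]
-/

open CategoryTheory Function Finset

noncomputable section

namespace Literature.Topology.FourManifolds

namespace GaussDiagram

open KhElim

/-! ## The first Reidemeister move -/

section R1

variable {G : GaussDiagram} (tf : Bool)

/-- In Lee's theory a nonzero coefficient of multiplication by `X` at `α` means: `u` is `s` with
the label of the circle of `α` swapped (`1 · X = X`, `X · X = 1`). [folklore] -/
theorem eq_actX_of_leeActCoeff_ne_zero {α : G.Arc} {s u : G.EnhancedState}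
    (h0 : actCoeff ℚ 0 1 α true s u ≠ 0) : u = s.actX α := by
  unfold actCoeff at h0
  split_ifs at h0 with hc
  · obtain ⟨hst, hoff⟩ := hc
    have hl : u.label α = !s.label α := by
      revert h0
      cases s.label α <;> cases u.label α <;> simp [mergeCoeff]
    refine EnhancedState.ext' hst (funext fun c ↦ ?_)
    rw [EnhancedState.actX_label]
    by_cases hr : (G.stateGraph s.state).Reachable α c
    · rw [if_pos hr, s.label_eq_of_reachable hr.symm]
      have : u.label c = u.label α := u.label_eq_of_reachable (by rw [hst]; exact hr.symm)
      rw [this, hl]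
    · rw [if_neg hr]
      exact hoff c (fun hc ↦ hr (circleOf_eq_iff.1 hc).symm)
  · exact (h0 rfl).elim

/-- **Multiplication by `X` is filtered of degree `-2` in Lee's theory.** Rasmussen (2010),
Lemma 3.5. [cite: Rasmussen2010, Lemma 3.5] -/
theorem qDegree_le_of_leeActCoeff_ne_zero {α : G.Arc} {s u : G.EnhancedState}
    (h0 : actCoeff ℚ 0 1 α true s u ≠ 0) : qDegree s - 2 ≤ qDegree u := by
  rw [eq_actX_of_leeActCoeff_ne_zero h0]
  exact qDegree_sub_two_le_qDegree_actX s α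

/-- The `1`-component of the comultiplication at `α` is filtered of degree `-2` in Lee's theory.
[folklore] -/
theorem qDegree_le_of_leeCoactCoeff_false_ne_zero {α : G.Arc} {s u : G.EnhancedState}
    (h0 : coactCoeff ℚ 0 1 α false s u ≠ 0) : qDegree s - 2 ≤ qDegree u := by
  rw [coactCoeff_false] at h0
  simp only [ite_self, sub_zero] at h0
  exact qDegree_le_of_leeActCoeff_ne_zero h0

/-- A nonzero value of a basis vector pins the index. [folklore] -/
private theorem eq_of_single_ne_zero {α : Type*} [DecidableEq α] {a b : α} (h : (Pi.single a (1 : ℚ) : α → ℚ) b ≠ 0) :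
    b = a := by
  by_contra hne
  exact h (Pi.single_eq_of_ne hne 1)

/-- **The chain map `F` of the positive curl is filtered** (Lee's theory): `s ⊗ X` has the degree
of `s`, and `(X · s) ⊗ 1` has degree at least that of `s`. Rasmussen (2010), §6 (first move).
[cite: Rasmussen2010, §6] -/
theorem qFiltered_curlPosF : QFiltered (G.curlPosF tf (0 : ℚ) 1) := by
  intro t y hne
  rcases eq_curlLoopES_or_eq_curlThruES tf 1 y with ⟨u, x, rfl⟩ | ⟨u, rfl⟩
  · rw [qDegree_curlLoopES]
    cases x
    · rw [curlPosF_loop_false, neg_ne_zero] at hne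
      obtain ⟨s, -, hs⟩ := Finset.exists_ne_zero_of_sum_ne_zero hne
      have h1 : actCoeff ℚ 0 1 G.baseArc true s u ≠ 0 := left_ne_zero_of_mul hs
      obtain rfl : s = t := eq_of_single_ne_zero (right_ne_zero_of_mul hs)
      have := qDegree_le_of_leeActCoeff_ne_zero h1
      rw [labelDeg_false, Units.val_one]
      omega
    · rw [curlPosF_loop_true] at hne
      obtain rfl : u = t := eq_of_single_ne_zero hne
      rw [labelDeg_true, Units.val_one]
      omega
  · exact (hne (curlPosF_thru tf _ u)).elim

/-- **The chain map `B` of the positive curl is filtered.** [cite: Rasmussen2010, §6] -/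
theorem qFiltered_curlPosB : QFiltered (G.curlPosB (R := ℚ) tf) := by
  intro y s hne
  rw [curlPosB_apply] at hne
  rw [← eq_of_single_ne_zero hne, qDegree_curlLoopES, labelDeg_true, Units.val_one]
  omega

/-- **The chain map `F` of the negative curl is filtered.** [cite: Rasmussen2010, §6] -/
theorem qFiltered_curlNegF : QFiltered (G.curlNegF (R := ℚ) tf) := by
  intro t y hne
  rcases eq_curlLoopES_or_eq_curlThruES tf (-1) y with ⟨u, x, rfl⟩ | ⟨u, rfl⟩
  · cases x
    · rw [curlNegF_loop_false] at hne
      obtain rfl : u = t := eq_of_single_ne_zero hne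
      rw [qDegree_curlLoopES, labelDeg_false, Units.val_neg, Units.val_one]
      omega
    · exact (hne (curlNegF_loop_true tf _ u)).elim
  · exact (hne (curlNegF_thru tf _ u)).elim

/-- **The chain map `B` of the negative curl is filtered** (Lee's theory): `u ⊗ 1 ↦ u` keeps the
degree and `u ⊗ X ↦ -Δ₁(u)` does not decrease it. [cite: Rasmussen2010, §6] -/
theorem qFiltered_curlNegB : QFiltered (G.curlNegB tf (0 : ℚ) 1) := by
  intro y u' hne
  rw [curlNegB_apply] at hne
  by_cases h1 : (Pi.single y (1 : ℚ) : (G.curl tf (-1)).EnhancedState → ℚ) (curlLoopES tf (-1) u' false) ≠ 0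
  · rw [← eq_of_single_ne_zero h1, qDegree_curlLoopES, labelDeg_false, Units.val_neg, Units.val_one]
    omega
  · rw [not_ne_iff] at h1
    rw [h1, zero_sub, neg_ne_zero] at hne
    obtain ⟨u, -, hu⟩ := Finset.exists_ne_zero_of_sum_ne_zero hne
    have h2 : coactCoeff ℚ 0 1 G.baseArc false u u' ≠ 0 := left_ne_zero_of_mul hu
    rw [← eq_of_single_ne_zero (right_ne_zero_of_mul hu), qDegree_curlLoopES, labelDeg_true,
      Units.val_neg, Units.val_one]
    have := qDegree_le_of_leeCoactCoeff_false_ne_zero h2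
    omega

/-- **Rasmussen's `s` is invariant under a positive curl**, for every Gauss diagram (the homotopy
data of the first move are filtered). Rasmussen (2010), Thm. 1, §6. [cite: Rasmussen2010, §6] -/
theorem rasmussenInvariant_curl_one (G : GaussDiagram) (tf : Bool) :
    (G.curl tf 1).rasmussenInvariant = G.rasmussenInvariant := by
  symm
  exact (G.curlPosHtpy tf (0 : ℚ) 1).toHtpyEquiv'.rasmussenInvariant_eq_of_qFiltered
    (suppDeg_curlPosF tf 0 1) (suppDeg_curlPosB tf) (fun _ _ _ _ _ ↦ rfl) (suppDeg_curlPosH tf)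
    (qFiltered_curlPosF tf) (qFiltered_curlPosB tf)

/-- **Rasmussen's `s` is invariant under a negative curl**, for every Gauss diagram.
Rasmussen (2010), Thm. 1, §6. [cite: Rasmussen2010, §6] -/
theorem rasmussenInvariant_curl_neg_one (G : GaussDiagram) (tf : Bool) :
    (G.curl tf (-1)).rasmussenInvariant = G.rasmussenInvariant := by
  symm
  exact (G.curlNegHtpy tf (0 : ℚ) 1).toHtpyEquiv'.rasmussenInvariant_eq_of_qFiltered
    (suppDeg_curlNegF tf) (suppDeg_curlNegB tf 0 1) (fun _ _ _ _ _ ↦ rfl) (suppDeg_curlNegH tf)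
    (qFiltered_curlNegF tf) (qFiltered_curlNegB tf)

/-- **Rasmussen's `s` is invariant under a curl of either sign** at the last position.
[cite: Rasmussen2010, §6] -/
theorem rasmussenInvariant_curl (G : GaussDiagram) (tf : Bool) (ε : ℤˣ) :
    (G.curl tf ε).rasmussenInvariant = G.rasmussenInvariant := by
  rcases Int.units_eq_one_or ε with rfl | rfl
  · exact rasmussenInvariant_curl_one G tf
  · exact rasmussenInvariant_curl_neg_one G tf

/-- **Rasmussen's `s` is invariant under `Ω1a`** (`PolyakMove.omega1a`), for every Gauss diagram,
position and sign: a curl at the last position conjugated by rotations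
(`insertChord_castSucc_eq_rotate_curl`, `rasmussenInvariant_rotate`). Rasmussen (2010), Thm. 1,
§6. [cite: Rasmussen2010, §6] -/
theorem rasmussenInvariant_omega1a (G : GaussDiagram) (p : Fin (2 * G.n + 1)) (ε : ℤˣ) :
    (G.insertChord p.castSucc p ε).rasmussenInvariant = G.rasmussenInvariant := by
  rw [G.insertChord_castSucc_eq_rotate_curl p ε, rasmussenInvariant_rotate, rasmussenInvariant_curl,
    rasmussenInvariant_rotate]

/-- **Rasmussen's `s` is invariant under `Ω1b`** (`PolyakMove.omega1b`). [cite: Rasmussen2010, §6] -/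
theorem rasmussenInvariant_omega1b (G : GaussDiagram) (p : Fin (2 * G.n + 1)) (ε : ℤˣ) :
    (G.insertChord p.succ p ε).rasmussenInvariant = G.rasmussenInvariant := by
  rw [G.insertChord_succ_eq_rotate_curl p ε, rasmussenInvariant_rotate, rasmussenInvariant_curl,
    rasmussenInvariant_rotate]

/-- **Erasing an isolated kink entered along the under-strand does not change `s`** (`Ω1b`
backwards and renumbering). [cite: Rasmussen2010, §6] -/
theorem rasmussenInvariant_eraseChord_of_kink_under (x : Fin G.n) (h : (G.overPos x : ℕ) = G.underPos x + 1) :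
    (G.eraseChord x).rasmussenInvariant = G.rasmussenInvariant := by
  have e := (G.eraseChord x).rasmussenInvariant_omega1b (G.eraseU x) (G.sign x)
  rw [← G.eraseO_eq_succ x h, G.insertChord_eraseChord x, rasmussenInvariant_relabel] at e
  exact e.symm

/-- **Erasing an isolated kink entered along the over-strand does not change `s`** (`Ω1a`
backwards and renumbering). [cite: Rasmussen2010, §6] -/
theorem rasmussenInvariant_eraseChord_of_kink_over (x : Fin G.n) (h : (G.underPos x : ℕ) = G.overPos x + 1) :
    (G.eraseChord x).rasmussenInvariant = G.rasmussenInvariant := by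
  have e := (G.eraseChord x).rasmussenInvariant_omega1a (G.eraseU x) (G.sign x)
  rw [← G.eraseO_eq_castSucc x h, G.insertChord_eraseChord x, rasmussenInvariant_relabel] at e
  exact e.symm

end R1

/-! ## The second Reidemeister move -/

section R2

variable (G : GaussDiagram) (m : Fin (2 * G.n + 1)) (tf : Bool) (ε : ℤˣ)
  (hms : ∀ (τ : (G.bigon m tf ε).State) (k : Fin (G.bigon m tf ε).n), τ k = false →
    (G.bigon m tf ε).IsMergeAt τ k ∨ (G.bigon m tf ε).IsSplitAt τ k)

/-- **The homotopy data of the bigon are filtered in Lee's theory**: relabelling and rescaling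
keep the quantum degree, Lee's differential does not decrease it
(`qDegree_le_of_leeIncidence_ne_zero`), and the two cancelled identity blocks `A → P`, `Q → U`
join states of equal quantum degree (they are nonzero entries of Khovanov's graded differential).
Rasmussen (2010), §6 (second move). [cite: Rasmussen2010, §6] -/
theorem isFilt_bigonMHtpy :
    (G.bigonMHtpy m tf ε (0 : ℚ) 1 hms).IsFilt (fun s ↦ qDegree s) (fun s ↦ qDegree (bigonD m tf ε s)) := by
  unfold bigonMHtpy
  refine MHtpy.IsFilt.trans (MHtpy.IsFilt.ofEquiv _ _ _ _ (dT := fun a ↦ qDegree (G.embSum m tf ε a))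
    (fun _ ↦ rfl)) ?_
  refine MHtpy.IsFilt.trans (MHtpy.IsFilt.rescale _ _ _ _) ?_
  have hI : ∀ a b, G.bigonJ' m tf ε (0 : ℚ) 1 a b ≠ 0 →
      qDegree (G.embSum m tf ε a) ≤ qDegree (G.embSum m tf ε b) := by
    intro a b hab
    apply qDegree_le_of_leeIncidence_ne_zero (G := G.bigon m tf ε)
    intro h0
    apply hab
    unfold bigonJ' bigonJ
    rw [h0, mul_zero, zero_mul]
  refine MHtpy.IsFilt.trans (MHtpy.IsFilt.congrRight _ (MHtpy.IsFilt.elim _ _ hI ?_)) ?_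
  · intro x
    simp only [embSum_inr_inl, embSum_inl]
    exact qDegree_eq_of_incidence_ne_zero_holds (incidence_embA_embP_self_ne_zero x)
  · refine MHtpy.IsFilt.congrRight _ (MHtpy.IsFilt.elim _ _ (fun a b hab ↦ hI _ _ hab) ?_)
    intro x
    simp only [embSum_inr_inr_inl, embSum_inr_inr_inr_inl]
    exact qDegree_eq_of_incidence_ne_zero_holds (incidence_embQ_embU_self_ne_zero x)

include hms in
/-- **Rasmussen's `s` is invariant under the second Reidemeister move (bigon in normal position)**,
for a bigon all of whose cube edges are merges or splits. Rasmussen (2010), Thm. 1, §6.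
[cite: Rasmussen2010, §6] -/
theorem rasmussenInvariant_bigon : (G.bigon m tf ε).rasmussenInvariant = G.rasmussenInvariant := by
  have hg := G.isGraded_bigonMHtpy m tf ε hms (G.admissibleDeg_homDegree m tf ε (0 : ℚ) 1)
  have hf := G.isFilt_bigonMHtpy m tf ε hms
  symm
  refine (G.bigonHtpyData m tf ε (0 : ℚ) 1 hms).toHtpyEquiv'.rasmussenInvariant_eq_of_qFiltered
    ?_ ?_ (fun _ _ _ _ _ ↦ rfl) ?_ ?_ ?_
  · intro k w hw s hs
    refine hg.F.apply_eq_zero_fst (i := k) (fun t ht ↦ hw t ?_) ?_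
    · simpa [homDegree_bigonD] using ht
    · simpa using hs
  · intro k v hv s hs
    refine hg.B.apply_eq_zero_fst (i := k) (fun t ht ↦ hv t (by simpa using ht)) ?_
    simpa [homDegree_bigonD] using hs
  · intro k v hv s hs
    refine hg.H.apply_eq_zero_fst (i := k) (fun t ht ↦ hv t (by simpa using ht)) ?_
    simp only [ne_eq]
    intro h
    exact hs (by omega)
  · intro t s hne
    have := hf.F t s hne
    rwa [qDegree_bigonD] at this
  · intro s t hne
    have := hf.B s t hne
    rwa [qDegree_bigonD] at this

end R2

/-- **Rasmussen's `s` is invariant under `Ω2a`** (`PolyakMove.omega2a`), for every instance all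
of whose cube edges (of the target) are merges or splits: a bigon in normal position conjugated
by rotations (`insertChord_insertChord_eq_rotate_bigon`). Rasmussen (2010), Thm. 1, §6.
[cite: Rasmussen2010, §6] -/
theorem rasmussenInvariant_omega2a (G : GaussDiagram) (o : Fin (2 * G.n + 2)) (u : Fin (2 * G.n + 1))
    (o' : Fin (2 * (G.n + 1) + 2)) (u' : Fin (2 * (G.n + 1) + 1)) (ε : ℤˣ)
    (hover : (((G.insertChord o u ε).insertChord o' u' (-ε)).overPos (Fin.last (G.n + 1)) : ℕ) =
      ((G.insertChord o u ε).insertChord o' u' (-ε)).overPos (Fin.last G.n).castSucc + 1)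
    (hunder : (((G.insertChord o u ε).insertChord o' u' (-ε)).underPos (Fin.last (G.n + 1)) : ℕ) =
      ((G.insertChord o u ε).insertChord o' u' (-ε)).underPos (Fin.last G.n).castSucc + 1)
    (hms : ∀ (τ : ((G.insertChord o u ε).insertChord o' u' (-ε)).State)
      (k : Fin ((G.insertChord o u ε).insertChord o' u' (-ε)).n), τ k = false →
      ((G.insertChord o u ε).insertChord o' u' (-ε)).IsMergeAt τ k ∨
        ((G.insertChord o u ε).insertChord o' u' (-ε)).IsSplitAt τ k) :
    ((G.insertChord o u ε).insertChord o' u' (-ε)).rasmussenInvariant = G.rasmussenInvariant := by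
  rw [G.insertChord_insertChord_eq_rotate_bigon o u o' u' ε hover hunder] at hms ⊢
  rw [rasmussenInvariant_rotate, rasmussenInvariant_bigon _ _ _ _ (dichotomy_of_rotate _ _ hms),
    rasmussenInvariant_rotate]

/-! ## The third Reidemeister move -/

namespace LoopSq

variable {K : GaussDiagram} (L : K.LoopSq) (o₀ : K.Arc) (ho₀ : L.InO o₀)
  (hms : ∀ (τ : K.State) (k : Fin K.n), τ k = false → K.IsMergeAt τ k ∨ K.IsSplitAt τ k)
  (hPm : ∀ (σ : K.State) (j : Fin K.n), L.P σ → L.P (Function.update σ j true))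

/-- Nonzero entries of the matrix after the first cancellation do not decrease the quantum degree
(Lee's theory). [folklore] -/
theorem qDegree_le_of_loopJ''_ne_zero (a b : L.XA ⊕ (L.XA ⊕ L.XR)) (hab : L.loopJ'' (0 : ℚ) 1 a b ≠ 0) :
    qDegree (L.embSum (.inr (.inr a))) ≤ qDegree (L.embSum (.inr (.inr b))) := by
  have hI : ∀ a b, L.loopJ' (0 : ℚ) 1 a b ≠ 0 → qDegree (L.embSum a) ≤ qDegree (L.embSum b) := by
    intro a b hab
    apply qDegree_le_of_leeIncidence_ne_zero (G := K)
    intro h0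
    apply hab
    unfold loopJ' loopJ
    rw [h0, mul_zero, zero_mul]
  unfold loopJ'' redI at hab
  by_cases h1 : L.loopJ' (0 : ℚ) 1 (.inr (.inr a)) (.inr (.inr b)) ≠ 0
  · exact hI _ _ h1
  · rw [not_ne_iff] at h1
    rw [h1, zero_sub, neg_ne_zero] at hab
    obtain ⟨x, -, hx⟩ := Finset.exists_ne_zero_of_sum_ne_zero hab
    have h2 : L.loopJ' (0 : ℚ) 1 (.inr (.inr a)) (.inr (.inl x)) ≠ 0 := left_ne_zero_of_mul hx
    have h3 : L.loopJ' (0 : ℚ) 1 (.inl x) (.inr (.inr b)) ≠ 0 := right_ne_zero_of_mul hx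
    have e2 := hI _ _ h2; have e3 := hI _ _ h3
    have e4 : qDegree (L.embSum (.inr (.inl x))) = qDegree (L.embSum (.inl x)) := by
      simp only [embSum_inr_inl, embSum_inl]
      exact qDegree_eq_of_incidence_ne_zero_holds (incidence_embA_embP_self_ne_zero x)
    rw [e4] at e2
    exact e2.trans e3

/-- **The retraction of a loop square onto its rest is filtered in Lee's theory.**
Rasmussen (2010), §6 (third move). [cite: Rasmussen2010, §6] -/
theorem isFilt_loopMHtpy :
    (L.loopMHtpy o₀ ho₀ (0 : ℚ) 1 hms hPm).IsFilt (fun s ↦ qDegree s) (fun r ↦ qDegree r.1) := by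
  unfold loopMHtpy
  refine MHtpy.IsFilt.trans (MHtpy.IsFilt.ofEquiv _ _ _ _ (dT := fun a ↦ qDegree (L.embSum a)) (fun _ ↦ rfl)) ?_
  refine MHtpy.IsFilt.trans (MHtpy.IsFilt.rescale _ _ _ _) ?_
  have hI : ∀ a b, L.loopJ' (0 : ℚ) 1 a b ≠ 0 → qDegree (L.embSum a) ≤ qDegree (L.embSum b) := by
    intro a b hab
    apply qDegree_le_of_leeIncidence_ne_zero (G := K)
    intro h0
    apply hab
    unfold loopJ' loopJ
    rw [h0, mul_zero, zero_mul]
  refine MHtpy.IsFilt.trans (MHtpy.IsFilt.elim _ _ hI ?_) ?_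
  · intro x
    simp only [embSum_inr_inl, embSum_inl]
    exact qDegree_eq_of_incidence_ne_zero_holds (incidence_embA_embP_self_ne_zero x)
  · refine MHtpy.IsFilt.congrRight _ (MHtpy.IsFilt.elim _ _
      (fun a b hab ↦ L.qDegree_le_of_loopJ''_ne_zero a b hab) ?_)
    intro x
    simp only [embSum_inr_inr_inl, embSum_inr_inr_inr_inl]
    exact qDegree_eq_of_incidence_ne_zero_holds (incidence_embQ_embU_self_ne_zero x)

end LoopSq

section R3

variable (G : GaussDiagram) {x y z : Fin G.n}
variable (hxz : x ≠ z) (ha : (G.overPos y : ℕ) = G.overPos x + 1) (hb : (G.overPos z : ℕ) = G.underPos x + 1)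
  (hc : (G.underPos z : ℕ) = G.underPos y + 1) (hx : G.sign x = 1) (hy : G.sign y = 1) (hz : G.sign z = 1)
variable (hms : ∀ (τ : G.State) (k : Fin G.n), τ k = false → G.IsMergeAt τ k ∨ G.IsSplitAt τ k)
  (hms' : ∀ (τ : (G.braidMove x y z).State) (k : Fin (G.braidMove x y z).n), τ k = false →
    (G.braidMove x y z).IsMergeAt τ k ∨ (G.braidMove x y z).IsSplitAt τ k)

/-- **The retraction of `C(G)` onto the rest of the rearrangement is filtered in Lee's theory**
(quantum degrees of the rest read in `G.braidMove x y z` through `toG'`, `qDegree_toG'`).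
[cite: Rasmussen2010, §6] -/
theorem isFilt_retractG :
    (G.retractG hxz ha hb hc hx hy hz (0 : ℚ) 1 hms).IsFilt (fun s ↦ qDegree s)
      (fun a : (G.triLoopSq' hxz ha hb hc hx hy hz).XR ↦ qDegree a.1) := by
  unfold retractG
  refine MHtpy.IsFilt.trans ((G.triLoopSq hxz ha hb hc hx hy hz).isFilt_loopMHtpy (G.sideA x) G.inT_sideA hms
    (G.hPm_tri hxz ha hb hc hx hy hz)) ?_
  refine MHtpy.IsFilt.trans (MHtpy.IsFilt.rescale _ _ _ _) ?_
  refine MHtpy.IsFilt.ofEquiv _ _ _ _ (fun a ↦ ?_)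
  conv_rhs => rw [← (G.restEquiv hxz ha hb hc hx hy hz).apply_symm_apply a]
  rw [restEquiv_apply, qDegree_toG']

/-- **The retraction of `C(G.braidMove x y z)` onto its rest is filtered.** [cite: Rasmussen2010, §6] -/
theorem isFilt_retractG' :
    (G.retractG' hxz ha hb hc hx hy hz (0 : ℚ) 1 hms').IsFilt (fun s ↦ qDegree s)
      (fun a : (G.triLoopSq' hxz ha hb hc hx hy hz).XR ↦ qDegree a.1) :=
  (G.triLoopSq' hxz ha hb hc hx hy hz).isFilt_loopMHtpy (G.sideA x) G.inT_sideA hms' (G.hPm_tri' hxz ha hb hc hx hy hz)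

include hxz ha hb hc hx hy hz hms hms' in
/-- **Rasmussen's `s` is invariant under the third Reidemeister move `Ω3a` with `x ≠ z`**, for
diagrams all of whose cube edges are merges or splits: the homotopy equivalence `omega3Equiv`
(two retractions onto a common complex) is degree-preserving and filtered both ways.
Rasmussen (2010), Thm. 1, §6. [cite: Rasmussen2010, §6] -/
theorem rasmussenInvariant_braidMove : (G.braidMove x y z).rasmussenInvariant = G.rasmussenInvariant := by
  have h1 := G.isGraded_retractG hxz ha hb hc hx hy hz (0 : ℚ) 1 hms (d' := fun s ↦ ((homDegree s : ℤ), (0 : ℤ)))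
    (LoopSq.admissibleDeg_homDegree (0 : ℚ) 1) (fun t h ↦ by simp only [G.homDegree_toG' hxz ha hb hc hx hy hz])
  have h2 := G.isGraded_retractG' hxz ha hb hc hx hy hz (0 : ℚ) 1 hms' (LoopSq.admissibleDeg_homDegree (0 : ℚ) 1)
  have f1 := G.isFilt_retractG hxz ha hb hc hx hy hz hms
  have f2 := G.isFilt_retractG' hxz ha hb hc hx hy hz hms'
  set D := G.omega3Equiv hxz ha hb hc hx hy hz (0 : ℚ) 1 hms hms' with hD
  have gF : Graded (fun s : G.EnhancedState ↦ ((homDegree s : ℤ), (0 : ℤ)))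
      (fun s : (G.braidMove x y z).EnhancedState ↦ ((homDegree s : ℤ), (0 : ℤ))) 0 D.F := by
    rw [hD, omega3Equiv, HtpyEquiv.ofRetractions_F]; simpa using h1.B.comp h2.F
  have gB : Graded (fun s : (G.braidMove x y z).EnhancedState ↦ ((homDegree s : ℤ), (0 : ℤ)))
      (fun s : G.EnhancedState ↦ ((homDegree s : ℤ), (0 : ℤ))) 0 D.B := by
    rw [hD, omega3Equiv, HtpyEquiv.ofRetractions_B]; simpa using h2.B.comp h1.F
  have gHG : Graded (fun s : G.EnhancedState ↦ ((homDegree s : ℤ), (0 : ℤ)))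
      (fun s : G.EnhancedState ↦ ((homDegree s : ℤ), (0 : ℤ))) (-1, 0) D.HG := by
    rw [hD, omega3Equiv, HtpyEquiv.ofRetractions_HG]; exact h1.H
  have gHK : Graded (fun s : (G.braidMove x y z).EnhancedState ↦ ((homDegree s : ℤ), (0 : ℤ)))
      (fun s : (G.braidMove x y z).EnhancedState ↦ ((homDegree s : ℤ), (0 : ℤ))) (-1, 0) D.HK := by
    rw [hD, omega3Equiv, HtpyEquiv.ofRetractions_HK]; exact h2.H
  have fF : QFiltered D.F := by
    rw [hD, omega3Equiv, HtpyEquiv.ofRetractions_F]; exact f1.B.comp f2.F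
  have fB : QFiltered D.B := by
    rw [hD, omega3Equiv, HtpyEquiv.ofRetractions_B]; exact f2.B.comp f1.F
  symm
  refine D.rasmussenInvariant_eq_of_qFiltered ?_ ?_ ?_ ?_ fF fB
  · intro k w hw s hs
    exact gF.apply_eq_zero_fst (i := k) (fun t ht ↦ hw t (by simpa using ht)) (by simpa using hs)
  · intro k v hv s hs
    exact gB.apply_eq_zero_fst (i := k) (fun t ht ↦ hv t (by simpa using ht)) (by simpa using hs)
  · intro k w hw s hs
    refine gHG.apply_eq_zero_fst (i := k) (fun t ht ↦ hw t (by simpa using ht)) ?_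
    simp only [ne_eq]; intro h; exact hs (by omega)
  · intro k v hv s hs
    refine gHK.apply_eq_zero_fst (i := k) (fun t ht ↦ hv t (by simpa using ht)) ?_
    simp only [ne_eq]; intro h; exact hs (by omega)

end R3

section R3Degenerate

variable (G : GaussDiagram) {x y : Fin G.n}
  (ha : (G.overPos y : ℕ) = G.overPos x + 1) (hb : (G.overPos x : ℕ) = G.underPos x + 1)
  (hc : (G.underPos x : ℕ) = G.underPos y + 1)

include ha hb hc in
/-- **Rasmussen's `s` is invariant under the degenerate instance `x = z` of `Ω3a`** (a kink inside
a kink): erase the kink `x`, then the kink `y`, from both sides (`eraseChord_eraseChord_eq`).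
Rasmussen (2010), Thm. 1, §6 (first move). [cite: Rasmussen2010, §6] -/
theorem rasmussenInvariant_braidMove_degenerate : (G.braidMove x y x).rasmussenInvariant = G.rasmussenInvariant := by
  have hxy : x ≠ y := by rintro rfl; omega
  have e₁ := G.rasmussenInvariant_eraseChord_of_kink_under x hb
  have e₂ := (G.eraseChord x).rasmussenInvariant_eraseChord_of_kink_under (G.yIdx x y hxy)
    (G.kink_eraseChord_G ha hb hc hxy)
  have e₃ := (G.braidMove x y x).rasmussenInvariant_eraseChord_of_kink_under x (G.kink_x_G' hc hxy)
  have e₄ := ((G.braidMove x y x).eraseChord x).rasmussenInvariant_eraseChord_of_kink_over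
    ((G.braidMove x y x).yIdx x y hxy) (G.kink_eraseChord_G' ha hb hc hxy)
  rw [← G.eraseChord_eraseChord_eq ha hb hc hxy] at e₄
  omega

end R3Degenerate

/-- **Rasmussen's `s` is invariant under `Ω3a`** (`PolyakMove.omega3a`, including the degenerate
instance `x = z`), for diagrams all of whose cube edges are merges or splits on both sides.
Rasmussen (2010), Thm. 1, §6. [cite: Rasmussen2010, §6] -/
theorem rasmussenInvariant_omega3a (G : GaussDiagram) (x y z : Fin G.n) (hx : G.sign x = 1) (hy : G.sign y = 1)
    (hz : G.sign z = 1) (ha : (G.overPos y : ℕ) = G.overPos x + 1) (hb : (G.overPos z : ℕ) = G.underPos x + 1)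
    (hc : (G.underPos z : ℕ) = G.underPos y + 1)
    (hms : ∀ (τ : G.State) (k : Fin G.n), τ k = false → G.IsMergeAt τ k ∨ G.IsSplitAt τ k)
    (hms' : ∀ (τ : (G.braidMove x y z).State) (k : Fin (G.braidMove x y z).n), τ k = false →
      (G.braidMove x y z).IsMergeAt τ k ∨ (G.braidMove x y z).IsSplitAt τ k) :
    (G.braidMove x y z).rasmussenInvariant = G.rasmussenInvariant := by
  by_cases hxz : x = z
  · subst hxz
    exact G.rasmussenInvariant_braidMove_degenerate ha hb hc
  · exact G.rasmussenInvariant_braidMove hxz ha hb hc hx hy hz hms hms'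


/-! ## All-even diagrams and the discharge -/

/-- **An all-even Gauss diagram satisfies the merge-or-split dichotomy**: at every `0`-smoothed
chord of every state the flip `0 → 1` joins two circles or cuts one (no one-to-one bifurcation),
by `isMergeAt_or_isSplitAt_of_overPos_mod_two_ne` (`KhResolutionsDichotomyProofs`: the parity
condition replaces planarity). Viro (2004), §5.2; Manturov (2007). [cite: Viro2004, §5.2] -/
theorem dichotomy_of_allEven {G : GaussDiagram} (h : G.AllEven) :
    ∀ (τ : G.State) (k : Fin G.n), τ k = false → G.IsMergeAt τ k ∨ G.IsSplitAt τ k :=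
  fun _ _ hk ↦ isMergeAt_or_isSplitAt_of_overPos_mod_two_ne h hk

/-- **A realisable Gauss diagram is all-even** (Gauss's parity condition,
`Knot.HasGaussDiagram.overPos_mod_two_ne_underPos_mod_two`). Kauffman (1999), §3.2, Lemma 1.
[cite: Kauffman1999, §3.2 Lemma 1] -/
theorem allEven_of_hasGaussDiagram {K : Knot} {G : GaussDiagram} (hK : K.HasGaussDiagram G) : G.AllEven :=
  fun j ↦ Knot.HasGaussDiagram.overPos_mod_two_ne_underPos_mod_two hK j

/-- **Rasmussen's `s` is invariant under every Polyak move between all-even Gauss diagrams**: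
the bookkeeping move by transport (`rasmussenInvariant_eq_of_isRelabelling`), `Ω1` for all
diagrams, `Ω2a` and `Ω3a` under the merge-or-split dichotomy of all-even diagrams.
Rasmussen (2010), Thm. 1, §6. [cite: Rasmussen2010, §6] -/
theorem rasmussenInvariant_eq_of_polyakMove_of_allEven {G H : GaussDiagram} (hm : PolyakMove G H)
    (hG : G.AllEven) (hH : H.AllEven) : H.rasmussenInvariant = G.rasmussenInvariant := by
  cases hm with
  | relabel G' h => exact rasmussenInvariant_eq_of_isRelabelling h
  | omega1a p ε => exact G.rasmussenInvariant_omega1a p ε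
  | omega1b p ε => exact G.rasmussenInvariant_omega1b p ε
  | omega2a o u o' u' ε hover hunder =>
    exact G.rasmussenInvariant_omega2a o u o' u' ε hover hunder (dichotomy_of_allEven hH)
  | omega3a x y z hx hy hz ha hb hc =>
    exact G.rasmussenInvariant_omega3a x y z hx hy hz ha hb hc (dichotomy_of_allEven hG) (dichotomy_of_allEven hH)

/-- **Rasmussen's `s` is invariant under a Polyak move between all-even diagrams** (`EvenMove`).
[cite: Rasmussen2010, §6] -/
theorem rasmussenInvariant_eq_of_evenMove {G H : GaussDiagram} (h : EvenMove G H) :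
    G.rasmussenInvariant = H.rasmussenInvariant :=
  (rasmussenInvariant_eq_of_polyakMove_of_allEven h.1 h.2.1 h.2.2).symm

/-- **Rasmussen's `s` is invariant under equivalence through all-even diagrams** (`EvenEquiv`).
[cite: Rasmussen2010, §6] -/
theorem rasmussenInvariant_eq_of_evenEquiv {G G' : GaussDiagram} (h : EvenEquiv G G') :
    G.rasmussenInvariant = G'.rasmussenInvariant := by
  induction h with
  | rel _ _ h => exact rasmussenInvariant_eq_of_evenMove h
  | refl _ => rfl
  | symm _ _ _ ih => exact ih.symm
  | trans _ _ _ _ _ ih₁ ih₂ => exact ih₁.trans ih₂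

/-- **Invariance of Rasmussen's `s`** — discharge of the named fact
`rasmussenInvariant_eq_of_equiv` of `LeeRasmussen`: two *realisable* Gauss diagrams related by
Polyak's Reidemeister moves (`GaussDiagram.Equiv`, possibly through non-realisable diagrams) have
the same `s`. Proof: realisable diagrams are all-even (Gauss); equivalent all-even diagrams are
equivalent through all-even diagrams (Manturov's projection theorem `evenEquiv_of_equiv`,
`GaussDiagramParity`); and `s` is invariant under every Polyak move between all-even diagrams
(the homotopy equivalences of the moves on Lee's complex are filtered of degree `0`,
Rasmussen (2010), §6). Rasmussen (2010), Thm. 1; Goussarov–Polyak–Viro (2000), Thm. 1.B (the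
statement's context). [cite: Rasmussen2010, Thm. 1] -/
theorem rasmussenInvariant_eq_of_equiv_holds : rasmussenInvariant_eq_of_equiv := by
  intro G G' hG hG' e
  obtain ⟨K, hK⟩ := hG
  obtain ⟨K', hK'⟩ := hG'
  exact rasmussenInvariant_eq_of_evenEquiv
    (evenEquiv_of_equiv (allEven_of_hasGaussDiagram hK) (allEven_of_hasGaussDiagram hK') e)


end GaussDiagram

end Literature.Topology.FourManifolds
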